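import Literature.AnabelianGeometry.EtaleTheta.KummerLevelRecordsNonVacuity
import Literature.AnabelianGeometry.EtaleTheta.ThetaLiftUnique
import Literature.AnabelianGeometry.EtaleTheta.SettingModelKummerDataEmpty
import HarnessLib

/-!
# [EtTh] §1: the compatibility `ConstCompat` of the two Kummer theories of constants, as typed — a SCHEMA
# decided by the existence of Kummer data (FACT-LIST row F-0618; proof-only companion of `ThetaKummerClass.lean`)

Mochizuki, *The étale theta function …*, Publ. RIMS **45** (2009) [EtTh], §1, Prop. 1.3 p. 21 ("where
`O^×_K̈` acts … via the composite of the Kummer map `O^×_K̈ → H¹(G_K̈, Δ_Θ)` with the natural map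
`H¹(G_K̈, Δ_Θ) → H¹(Π^tp_Ÿ, Δ_Θ)`") and Prop. 1.4 (iii) p. 22 [cite: MochizukiEtTh2009, Prop 1.3 p.21].

PROOF-ONLY file (abc-iut cell, block F fact-proving wave, seat abc-iut-f-117 floating on batch-2 tranche 145;
FACT-LIST row **F-0618** `Literature.AnabelianGeometry.EtaleTheta.ThetaSetting.ThetaKummerInput.ConstCompat`,
kernel_closedness = parametrised).  abc-iut-L2-t12's `T.ConstCompat E` (`ThetaKummerClass.lean`) relates TWO
independent interface records over a theta setting `D`: abc-iut-L2-t1's abstract Kummer datum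
`E : D.KummerData` (injections `K̈^× ↪ (K̈^×)^∧ ↪ H¹((Π^tp_Ÿ)^Θ, Δ_Θ)`) and the function-theoretic input
`T : D.ThetaKummerInput` (a group of functions with roots and a cyclotome identification), asking that the
inflated abstract Kummer class of every constant `c ∈ K̈^×` equal the bridge's Kummer class `κ(c)`.  Kernel
truth table (plan header rule R1):

* `ThetaKummerInput.not_constCompat_of_kummerConst_eq_one` — a theta-Kummer input whose Kummer classes of
  constants are ALL trivial (abc-iut-w5's DEGENERATE inhabitant `exists_thetaKummerInput_kummerTheta_eq_one`,
  `KummerLevelRecordsNonVacuity.lean`: `Fn = 1`, coefficient homomorphism trivial) is compatible with NO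
  Kummer datum: `ConstCompat` would make `infl ∘ kumYdd ∘ toKddHat` — injective (`inflTheta_injective`,
  abc-iut-L2-t12; `kumYdd_injective`, `toKddHat_injective`) — vanish on `K̈^×`, but `−1 ≠ 1` in `K̈^×`
  (characteristic `0`);
* `exists_thetaKummerInput_forall_not_constCompat` — hence over EVERY theta setting there is a `T` with
  `∀ E, ¬ T.ConstCompat E` (unconditional), and `KummerData.exists_thetaKummerInput_not_constCompat` — every
  Kummer datum has an incompatible theta-Kummer input;
* **exact reduction** `forall_constCompat_iff_isEmpty_kummerData : (∀ T E, T.ConstCompat E) ↔ IsEmpty D.KummerData`,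
  the full closure `forall_constCompat_iff_forall_isEmpty_kummerData`, and the root-model vacuity
  `model_forall_constCompat` (abc-iut-w5-d171 `ThetaSetting.model_isEmpty_kummerData`).

So F-0618 is a SCHEMA: a genuine constraint on the PAIR `(T, E)` ("what a construction of `KummerData` from
`T` would satisfy by definition", trunk docstring), false as a universal closure over any setting with Kummer
data, vacuous at the root model; consumed only as a HYPOTHESIS (`hT : T.ConstCompat E` in `IsThetaKummer`,
`ThetaKummerDeck`, `ThetaKummerClass.mem_kumUnitsYdd_iff`).  A positive instance (a compatible pair) needs a
function-theoretic `ThetaKummerInput` with injective Kummer map of constants — not in the tree (recorded, not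
claimed).  HONEST FRAMING: statements about the TYPED predicate over abstract interface data; nothing of [EtTh]
is asserted or denied; no side is taken on [IUTchIII] Cor. 3.12; typed ≠ proved.  No definitions, no instances,
no Prop facts.
-/

noncomputable section

namespace Literature.AnabelianGeometry.EtaleTheta

open Literature.AnabelianGeometry.SemiGraphs

namespace ThetaSetting

variable {p : ℕ} [Fact p.Prime] {D : ThetaSetting p}

variable (D) in
/-- `−1 ≠ 1` in `K̈^×` (`K̈ ⊆ ℚ̄_p` has characteristic `0`). [folklore] -/
private theorem neg_one_ne_one_unitsKdd : (-1 : (↥D.Kdd)ˣ) ≠ 1 := by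
  intro h
  have h1 : ((-1 : (↥D.Kdd)ˣ) : ↥D.Kdd) = 1 := by rw [h, Units.val_one]
  rw [Units.val_neg, Units.val_one] at h1
  have h2 : (D.Kdd.val) (-1) = (D.Kdd.val) 1 := by rw [h1]
  rw [map_neg, map_one] at h2
  haveI : CharZero (PadicAlgCl p) :=
    charZero_of_injective_algebraMap (algebraMap ℚ_[p] (PadicAlgCl p)).injective
  have h3 : (2 : PadicAlgCl p) = 0 := by linear_combination -h2
  exact two_ne_zero h3

namespace KummerData

variable (E : D.KummerData)

/-- The composite `K̈^× → (K̈^×)^∧ → H¹((Π^tp_Ÿ)^Θ, Δ_Θ) → H¹(Π^tp_Ÿ, Δ_Θ)` of a Kummer datum is injective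
(`toKddHat`, `kumYdd` injective by the interface; inflation injective in degree one, abc-iut-L2-t12).
[cite: MochizukiEtTh2009, Prop 1.5 (ii) p.23] -/
theorem inflTheta_kumYdd_toKddHat_injective :
    Function.Injective fun c : (↥D.Kdd)ˣ => D.inflTheta D.GtpYdd (E.kumYdd (E.toKddHat c)) :=
  ((D.inflTheta_injective D.GtpYdd).comp E.kumYdd_injective).comp E.toKddHat_injective

/-- Hence the inflated abstract Kummer class of `−1 ∈ K̈^×` is nontrivial for every Kummer datum.
[cite: MochizukiEtTh2009, Prop 1.5 (ii) p.23] -/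
theorem inflTheta_kumYdd_toKddHat_neg_one_ne_one :
    D.inflTheta D.GtpYdd (E.kumYdd (E.toKddHat (-1))) ≠ 1 := by
  intro h
  apply D.neg_one_ne_one_unitsKdd
  apply E.inflTheta_kumYdd_toKddHat_injective
  simp only [h, map_one]

end KummerData

namespace ThetaKummerInput

variable (T : D.ThetaKummerInput)

/-- **A theta-Kummer input with trivial Kummer classes of constants is compatible with NO Kummer datum**:
`ConstCompat` would force the injective composite `K̈^× → H¹(Π^tp_Ÿ, Δ_Θ)` of `E` to vanish, already at `−1`.
[cite: MochizukiEtTh2009, Prop 1.3 p.21] -/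
theorem not_constCompat_of_kummerConst_eq_one (hT : ∀ c, T.kummerConst c = 1) (E : D.KummerData) :
    ¬ T.ConstCompat E := fun h =>
  E.inflTheta_kumYdd_toKddHat_neg_one_ne_one ((h (-1)).trans (hT (-1)))

/-- Conversely, `ConstCompat` makes the bridge's Kummer map of constants `κ : K̈^× → H¹(Π^tp_Ÿ, Δ_Θ)` injective
(it then agrees with the injective composite of `E`). [cite: MochizukiEtTh2009, Prop 1.3 p.21] -/
theorem kummerConst_injective_of_constCompat {E : D.KummerData} (h : T.ConstCompat E) :
    Function.Injective T.kummerConst := by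
  have : T.kummerConst = fun c => D.inflTheta D.GtpYdd (E.kumYdd (E.toKddHat c)) := funext fun c => (h c).symm
  rw [this]
  exact E.inflTheta_kumYdd_toKddHat_injective

/-- In particular a compatible theta-Kummer input has `κ(−1) ≠ 1` (its Kummer map of constants is not
trivial). [cite: MochizukiEtTh2009, Prop 1.3 p.21] -/
theorem kummerConst_neg_one_ne_one_of_constCompat {E : D.KummerData} (h : T.ConstCompat E) :
    T.kummerConst (-1) ≠ 1 := fun h1 =>
  E.inflTheta_kumYdd_toKddHat_neg_one_ne_one ((h (-1)).trans h1)

end ThetaKummerInput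

variable (D) in
/-- **Over EVERY theta setting there is a theta-Kummer input compatible with NO Kummer datum** (the degenerate
inhabitant of abc-iut-w5's census, `KummerLevelRecordsNonVacuity`). [cite: MochizukiEtTh2009, Prop 1.3 p.21] -/
theorem exists_thetaKummerInput_forall_not_constCompat :
    ∃ T : D.ThetaKummerInput, ∀ E : D.KummerData, ¬ T.ConstCompat E := by
  obtain ⟨T, -, hT⟩ := exists_thetaKummerInput_kummerTheta_eq_one D
  exact ⟨T, T.not_constCompat_of_kummerConst_eq_one hT⟩

/-- Every Kummer datum admits an INcompatible theta-Kummer input. [cite: MochizukiEtTh2009, Prop 1.3 p.21] -/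
theorem KummerData.exists_thetaKummerInput_not_constCompat (E : D.KummerData) :
    ∃ T : D.ThetaKummerInput, ¬ T.ConstCompat E := by
  obtain ⟨T, hT⟩ := D.exists_thetaKummerInput_forall_not_constCompat
  exact ⟨T, hT E⟩

variable (D) in
/-- **F-0618, exact reduction**: `ConstCompat` holds for ALL pairs `(T, E)` over `D` iff `D` carries NO Kummer
data (then vacuously). [cite: MochizukiEtTh2009, Prop 1.3 p.21] -/
theorem forall_constCompat_iff_isEmpty_kummerData :
    (∀ (T : D.ThetaKummerInput) (E : D.KummerData), T.ConstCompat E) ↔ IsEmpty D.KummerData := by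
  refine ⟨fun h => ⟨fun E => ?_⟩, fun h T E => (h.false E).elim⟩
  obtain ⟨T, hT⟩ := E.exists_thetaKummerInput_not_constCompat
  exact hT (h T E)

variable (D) in
/-- Dually: some pair `(T, E)` over `D` violates `ConstCompat` iff `D` carries Kummer data (`ThetaKummerInput` is
always inhabited). [cite: MochizukiEtTh2009, Prop 1.3 p.21] -/
theorem exists_not_constCompat_iff_nonempty_kummerData :
    (∃ (T : D.ThetaKummerInput) (E : D.KummerData), ¬ T.ConstCompat E) ↔ Nonempty D.KummerData := by
  refine ⟨fun ⟨_, E, _⟩ => ⟨E⟩, fun ⟨E⟩ => ?_⟩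
  obtain ⟨T, hT⟩ := E.exists_thetaKummerInput_not_constCompat
  exact ⟨T, E, hT⟩

/-- **F-0618, the universal closure over everything**: `ConstCompat` holds for all primes, settings, theta-Kummer
inputs and Kummer data iff NO theta setting carries Kummer data — a SCHEMA row.
[cite: MochizukiEtTh2009, Prop 1.3 p.21] -/
theorem forall_constCompat_iff_forall_isEmpty_kummerData :
    (∀ (p : ℕ) [Fact p.Prime] (D : ThetaSetting p) (T : D.ThetaKummerInput) (E : D.KummerData), T.ConstCompat E) ↔
      ∀ (p : ℕ) [Fact p.Prime] (D : ThetaSetting p), IsEmpty D.KummerData :=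
  ⟨fun h p _ D => (D.forall_constCompat_iff_isEmpty_kummerData).mp (h p D),
    fun h p _ D => (D.forall_constCompat_iff_isEmpty_kummerData).mpr (h p D)⟩

/-- At the root model `ConstCompat` holds for every pair — vacuously (no Kummer data there, abc-iut-w5-d171).
[cite: MochizukiEtTh2009, Prop 1.3 p.21] -/
theorem model_forall_constCompat (p : ℕ) [Fact p.Prime] :
    ∀ (T : (ThetaSetting.model p).ThetaKummerInput) (E : (ThetaSetting.model p).KummerData), T.ConstCompat E :=
  (forall_constCompat_iff_isEmpty_kummerData _).mpr (ThetaSetting.model_isEmpty_kummerData p)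


end ThetaSetting

end Literature.AnabelianGeometry.EtaleTheta

end
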